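/-
Copyright (c) 2026 the pub-hodgecm-mathlib formalisation cell (harness21).  Prover seat hodgecm-mathlib-LH4-p01 (g11): half-A line LH4, (L2-6)-dy «2-deep representatives by
COUNTING», brick (B2g) «THE 2-FREE LEVEL-TWO CLASS VALUES AT A FRAME» (the `ϖ²` twin of ★ (B2c-II) p853410 of LH10-p01 (g11)); 2026-09-03.
-/
import Literature.NumberTheory.Rogawski1990.DepthZeroKappaTransferTypeTwoLevelTwoPlaceCount      -- (B2f) (this seat): `ncard_fixedBy_levelTwo_eq_ncard_isSelfDualLattice_stable_levelTwo_of_frame` (brings ★ (B2c-I))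
import Literature.NumberTheory.Rogawski1990.DepthZeroKappaTransferTypeTwoClassTotalsAtFrame       -- ★ (B2b-II) p853378: `exists_ne_zero_and_valuation_sq_mul_eq_one_iff_even_log` (§1 parity)
import Literature.NumberTheory.Automorphic.EndoscopicPairShiftLevelTwo                             -- (W2) (this seat): `UnitaryLatticeTree.cast_ncard_vertex_levelTwo_eq_of_total` (brings ★ ED.2 `shift_pairLetters`)
import Literature.NumberTheory.Rogawski1990.SelfDualStableLatticeCountInertPlace                  -- ★ F5-(0) p853304 (LH4-p01): `ncard_isSelfDualLattice_stable_eq_phiTHn_inertPlace ∕ _phiTHprimen_inertPlace`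
import Literature.NumberTheory.Rogawski1990.EndoscopicBlockFrameAlgHom                             -- ★ (O-5)-place: `exists_algHom_blockFrame_apply_eq_of_conj_place`
import Literature.NumberTheory.Rogawski1990.UnitOrbitalIntegralInertValueTHOfKappa                 -- ★ B-p12: the κ-reading kit (`exists_toLocalRing_eq_formValue`, `finKappaAt_eq_ite_even_of_nonsplit_of_isUnramifiedIn`, `sum_map_mulVec_mul_mulVec_eq_of_formCongr_eq`, `conjLocal_apply_eq_galAdicCompletionMap`)
import Literature.NumberTheory.Rogawski1990.FinExplicitTransferFactorKappaOddEigenline             -- ★ B-p14: `twistGram_apply_self_eq_formValue` (+ `mulVec_col_eq_smul_of_blockFrame`, `blockFrame_apply_corner`, `twistGram_blockFrame_eq`, `blockFrame_gram_hermitian`)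
import Literature.NumberTheory.Automorphic.UnitaryGroupIwasawaFiniteAdelic                          -- ★ `isUnit_placeForm_antidiagonal_unit_mem_glInt`, `placeForm_antidiagonal`
import Literature.NumberTheory.Weil1982.UnitaryLocalRingBaseField                                   -- ★ `exists_complexConj_eq_neg_ne_zero`
import HarnessLib

/-!
# The 2-free LEVEL-TWO class values of a depth-zero type-(2) match at an integral frame of the inert place ((B2f) ∘ (W2) ∘ ★ F5-(0), the class token discharged)

Topic `NumberTheory/Rogawski1990`; namespace `Literature.NumberTheory.Rogawski1990`.  THEOREMS ONLY (no definition, no instance, no notation, no named fact, no `sorry`); kernel lane `--supports stmt-HodgeConjecture-24833`.  Cell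
`pub/hodgecm-mathlib` (D-0151), crux H413 = `stmt-HodgeConjecture-24833`; half-A line LH4, organ (L2-6)-dy «2-deep representatives of the charged type-(2) classes at EVERY unramified inert place, by counting» (the 2-free twin of ★
`exists_twoDeepRepresentative_of_finExplicitDelta_ne_zero_typeTwo`, whose `√`-generator road needs `|2|_w = 1`).  Brick **(B2g) «LEVEL-TWO CLASS VALUES AT A FRAME»** = ★ (B2c-II) `DepthZeroKappaTransferTypeTwoRowZeroAtFrame` (LH10-p01
(g11)) with the level-one token `ϖ` replaced by `ϖ²`: same ≈ 50 binders except the depth letters, which are now depth TWO (`hg2 hu2`), guards `4 ≤ n`, `2 ≤ N`.  HONEST LABEL: HC_CM is proved only modulo the 7 printed citations (2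
remaining named inputs: hLiu418 = stmt-HodgeConjecture-24832, h413 = stmt-HodgeConjecture-24833) until rung 0 closes; count-neutral assembly of ★ bricks (pays no organ by itself; zero label movement; the level-two wall (L2-3) is not
touched).

THE MATHEMATICS.  (B2f): `n₀⁽²⁾(δ) := #{q ∈ Fix_δ(G′_v ⧸ K′) : (q⁻¹δq)_w ≡ 1 (mod ϖ²)} = #{M J₀-self-dual, (Tδ_wT⁻¹)M ⊆ M, (Tδ_wT⁻¹ − 1)M ⊆ ϖ²M}` (the token sees `ϖ` only through `|ϖ|`, §0); `Tδ_wT⁻¹ = φ_b(g_w, u_w)` (★ (O-5)-place);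
(W2) `cast_ncard_vertex_levelTwo_eq_of_total` = this LEVEL-TWO count is the TOTAL count of the TWICE-SHIFTED pair `(ϖ⁻²(g_w − 1), ϖ⁻²(u_w − 1))`, exponents `(n − 4, N − 2)`, once the total count is a function `G` of the exponents on
pairs carrying ★ F5-(0)'s letters `C` and the twice-shifted pair carries them (★ `shift_pairLetters` at the scalar `ϖ²` — whence the depth-two letters); ★ F5-(0): `G = phiTHn q` (class I) ∕ `phiTHprimen q` (class II), the class token
read from `κ_v(γ_H, δ)` as in ★ (B2c-II), whose steps (2)–(6) are repeated VERBATIM.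
[cite: Rogawski1990, §4.9 Lemma 4.9.3 p. 56, Prop. 4.9.1 (b) p. 55; §4.8 Case (a) p. 53] [cite: Kottwitz1986BaseChangeUnits, §1 pp. 240–241, §2 pp. 244–247] [cite: Flicker1998UnitaryFL, Prop. 11 p. 87, Props. 16–17 pp. 96–97, Theorem 18 p. 97]

* §0 `isIntMatrix_smul_iff_of_v_eq` (the level token depends on the scalar through `|·|` only);
* **`ncard_levelTwo_eq_phiTHn_of_frame_of_finKappaAt_eq_one`** (class I: `n₀⁽²⁾(δ) = Φ_{n−4}(N−2)`), **`ncard_levelTwo_eq_phiTHprimen_of_frame_of_finKappaAt_eq_neg_one`**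
  (class II: `n₀⁽²⁾(δ) = Φ′_{n−4}(N−2)`), `q = #𝓀(L⁺_v)`.

## References
* [Rogawski1990] J. D. Rogawski, *Automorphic Representations of Unitary Groups in Three Variables*, Ann. of Math. Stud. 123 (1990): §4.9 Lemma 4.9.3 p. 56, Prop. 4.9.1 (b) p. 55; §4.8 p. 53.
* [Kottwitz1986BaseChangeUnits] R. E. Kottwitz, *Base change for unit elements of Hecke algebras*, Compositio Math. 60 (1986): §1 pp. 240–241, §2 pp. 244–247.
* [Flicker1998UnitaryFL] Y. Z. Flicker, *Elementary proof of the fundamental lemma for a unitary group*, Canad. J. Math. 50 (1998): Prop. 11 p. 87, Props. 16–17, Theorem 18 p. 97.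
-/

set_option autoImplicit false

noncomputable section

open NumberField IsDedekindDomain Matrix Polynomial ValuativeRel
open scoped MatrixGroups WithZero ValuativeRel

namespace Literature.NumberTheory.Rogawski1990

open Literature.NumberTheory.Automorphic Literature.NumberTheory.Automorphic.UnitaryGroup Literature.NumberTheory.Automorphic.IntegralReduction
open Literature.NumberTheory.Automorphic.UnitaryLatticeTree Literature.NumberTheory.Automorphic.HermitianLattice Literature.NumberTheory.GaloisRepresentations Literature.NumberTheory.NumberFields
open Literature.NumberTheory.Rogawski1990.Flicker1998 (phiTHn phiTHprimen)

/-! ## §0 The level token depends on the scalar only through its valuation -/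

/-- `IsIntMatrix (c • X) ↔ IsIntMatrix (c′ • X)` when `|c| = |c′|`. [cite: Kottwitz1986BaseChangeUnits, §2 pp. 244–247] -/
theorem isIntMatrix_smul_iff_of_v_eq {K : Type*} [Field K] [Valued K ℤᵐ⁰] {N : ℕ} {c c' : K} (h : Valued.v c = Valued.v c')
    (X : Matrix (Fin N) (Fin N) K) : IsIntMatrix (c • X) ↔ IsIntMatrix (c' • X) := by
  refine forall_congr' fun i => forall_congr' fun j => ?_
  rw [Matrix.smul_apply, Matrix.smul_apply, smul_eq_mul, smul_eq_mul, map_mul, map_mul, h]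

variable (L : Type) [Field L] [NumberField L] [IsCMField L] (H' : Matrix (Fin 3) (Fin 3) L)
  {v : HeightOneSpectrum (𝓞 ↥(maximalRealSubfield L))}

section Frame

variable {L H'}
  (hH' : (H'.map (IsCMField.complexConj L))ᵀ = H') (w : PlacesOver L v)
  (hw : IsCMField.complexConj L • w.1 = w.1) (hv : Algebra.IsUnramifiedIn (𝓞 L) v.asIdeal) (hH'u : IsUnit H')
  {γH : (cmDatum L 2 (Matrix.of fun i j : Fin 2 => if i.val + j.val + 1 = 2 then (1 : L) else 0)).Local v ×
    (cmDatum L 1 (Matrix.of fun i j : Fin 1 => if i.val + j.val + 1 = 1 then (1 : L) else 0)).Local v}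
  (hreg : IsLocalGRegular L v γH)
  (hirr : ¬ ∃ x : w.1.adicCompletion L, (((γH.1.val : GL (Fin 2) (LocalRing L v)).val.map
      (Pi.evalRingHom (fun w' : PlacesOver L v => w'.1.adicCompletion L) w)).charpoly).IsRoot x)
  (δ : (cmDatum L 3 H').Local v) (h : IsLocalNormPair L H' v γH δ)
  (ht : ∀ m : ℕ, ValuativeRel.valuation (w.1.adicCompletion L)
    (((((δ.val : GL (Fin 3) (LocalRing L v)).val.map (Pi.evalRingHom (fun w' : UnitaryGroup.PlacesOver L v => w'.1.adicCompletion L) w))).charpoly -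
      (Polynomial.X - 1) ^ 3).coeff m) < 1)
  {cj : GL (Fin 3) (LocalRing L v)}
  (hcj : cj * ((endoEmbLocal L v γH).val : GL (Fin 3) (LocalRing L v)) * cj⁻¹ = (δ.val : GL (Fin 3) (LocalRing L v)))
  (T : GL (Fin 3) (w.1.adicCompletion L)) (hTint : T ∈ glInt 3 (w.1.adicCompletion L))
  (hJT : placeForm H' w.1 = formCongr (galAdicCompletionMap (L := L) (IsCMField.complexConj L) hw) T ((StdForm.antidiagonal 3).over (w.1.adicCompletion L)))
  -- ★ F5-(0)'s θ-package of the row (`F := L⁺`, `E := L`, `c := complexConj`)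
  {M : Type} [Field M] [NumberField M] [Algebra L M] (w₁ : PlacesOver M w.1)
  {aF k₀ : v.adicCompletion ↥(maximalRealSubfield L)} (haF : Valued.v aF < 1) (hk₀ : Valued.v k₀ = WithZero.exp (-1 : ℤ))
  {θ : w₁.1.adicCompletion M} (s' : w₁.1.adicCompletion M →+* w₁.1.adicCompletion M)
  (hθ : θ ^ 2 = toPlace w.1 w₁ (toPlace v w aF) * θ + toPlace w.1 w₁ (toPlace v w k₀)) (hθv : Valued.v θ = WithZero.exp (-1 : ℤ))
  (hcoord : ∀ z : w₁.1.adicCompletion M, ∃! pq : w.1.adicCompletion L × w.1.adicCompletion L, z = toPlace w.1 w₁ pq.1 + toPlace w.1 w₁ pq.2 * θ)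
  (hint : ∀ p q : w.1.adicCompletion L, toPlace w.1 w₁ p + toPlace w.1 w₁ q * θ ∈ 𝒪[w₁.1.adicCompletion M] ↔ p ∈ 𝒪[w.1.adicCompletion L] ∧ q ∈ 𝒪[w.1.adicCompletion L])
  (hs'ι : ∀ x, s' (toPlace w.1 w₁ x) = toPlace w.1 w₁ (galAdicCompletionMap (L := L) (IsCMField.complexConj L) hw x)) (hs'θ : s' θ = θ) (hs's' : ∀ z, s' (s' z) = z)
  (hs'O : ∀ z : 𝒪[w₁.1.adicCompletion M], s' z ∈ 𝒪[w₁.1.adicCompletion M]) (hs'v : ∀ z, Valued.v (s' z) = Valued.v z)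
  (hnorm1 : ∀ c₁ : w₁.1.adicCompletion M, c₁ ≠ 0 → s' c₁ = c₁ → Even (WithZero.log (Valued.v c₁)) → ∃ a : w₁.1.adicCompletion M, a * s' a * c₁ = 1)
  -- the block frame `c_fr = T · c_w` and its algebra map (★ `exists_algHom_blockFrame`)
  (cfr : GL (Fin 3) (w.1.adicCompletion L))
  (hcfr : (cfr : Matrix (Fin 3) (Fin 3) (w.1.adicCompletion L)) = (T : Matrix (Fin 3) (Fin 3) (w.1.adicCompletion L)) *
    ((cj : GL (Fin 3) (LocalRing L v)) : Matrix (Fin 3) (Fin 3) (LocalRing L v)).map (Pi.evalRingHom (fun w' : PlacesOver L v => w'.1.adicCompletion L) w))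
  (φb : (Matrix (Fin 2) (Fin 2) (w.1.adicCompletion L) × w.1.adicCompletion L) →ₐ[w.1.adicCompletion L] Matrix (Fin 3) (Fin 3) (w.1.adicCompletion L))
  (hφb : ∀ (g : Matrix (Fin 2) (Fin 2) (w.1.adicCompletion L)) (u : w.1.adicCompletion L),
    φb (g, u) = (cfr : Matrix (Fin 3) (Fin 3) (w.1.adicCompletion L)) *
      Matrix.reindex endoPerm endoPerm (Matrix.fromBlocks g 0 0 (u • (1 : Matrix (Fin 1) (Fin 1) (w.1.adicCompletion L)))) *
      ((cfr⁻¹ : GL (Fin 3) (w.1.adicCompletion L)) : Matrix (Fin 3) (Fin 3) (w.1.adicCompletion L)))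
  (φ : (w.1.adicCompletion L × w₁.1.adicCompletion M) →ₐ[w.1.adicCompletion L] Matrix (Fin 3) (Fin 3) (w.1.adicCompletion L)) (hφ : Function.Injective φ)
  (hstar : ∀ b : w.1.adicCompletion L × w₁.1.adicCompletion M, (StdForm.antidiagonal 3).over (w.1.adicCompletion L) *
    φ (RingHom.prodMap (galAdicCompletionMap (L := L) (IsCMField.complexConj L) hw) s' b) =
      ((φ b).map (galAdicCompletionMap (L := L) (IsCMField.complexConj L) hw))ᵀ * (StdForm.antidiagonal 3).over (w.1.adicCompletion L))
  -- the Eisenstein block of the (B3) head (★ F2 `exists_eisensteinData` ∕ ★ (W1)'s letters, `ϖ`-currency)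
  {ϖ : w.1.adicCompletion L} (hϖ : Valued.v ϖ = WithZero.exp (-1 : ℤ))
  {Θ : Matrix (Fin 2) (Fin 2) (w.1.adicCompletion L)} {α β a b : w.1.adicCompletion L}
  (hΘ : Θ = α • (1 : Matrix (Fin 2) (Fin 2) (w.1.adicCompletion L)) +
    β • ((γH.1.val : GL (Fin 2) (LocalRing L v)).val.map (Pi.evalRingHom (fun w' : PlacesOver L v => w'.1.adicCompletion L) w)))
  (hΘd : Valued.v Θ.det = Valued.v ϖ) (hΘt : Valued.v Θ.trace < 1)
  (hrel : finGammaTwo L v γH w • (1 : Matrix (Fin 2) (Fin 2) (w.1.adicCompletion L)) -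
      (γH.1.val : GL (Fin 2) (LocalRing L v)).val.map (Pi.evalRingHom (fun w' : PlacesOver L v => w'.1.adicCompletion L) w) =
    a • (1 : Matrix (Fin 2) (Fin 2) (w.1.adicCompletion L)) + b • Θ)
  (n N : ℕ) (hn : Valued.v (((finCharpolyTwo L v γH).eval (finGammaTwo L v γH)) w) = WithZero.exp (-(n : ℤ)))
  (hb : Valued.v b = Valued.v ϖ ^ N)
  -- the depth-TWO letters of the level-two shift (`g_w ≡ 1` entrywise and `u_w ≡ 1 (mod ϖ²)`)
  (hg2 : ∀ i j, Valued.v ((((γH.1.val : GL (Fin 2) (LocalRing L v)).val.map (Pi.evalRingHom (fun w' : PlacesOver L v => w'.1.adicCompletion L) w)) - 1) i j) ≤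
    WithZero.exp (-2 : ℤ))
  (hu2 : Valued.v (finGammaTwo L v γH w - 1) ≤ WithZero.exp (-2 : ℤ))
  -- ★ F5-(0)'s pair letters: a root `λ ∈ M_{w₁}` of `χ_{g_w}`, `φ(u_w, λ) = φ_b(g_w, u_w)`, the Krylov unit, generation, coordinates, the ⋆-polynomial
  {lam : w₁.1.adicCompletion M}
  (hlam : lam ^ 2 - toPlace w.1 w₁ ((γH.1.val : GL (Fin 2) (LocalRing L v)).val.map (Pi.evalRingHom (fun w' : PlacesOver L v => w'.1.adicCompletion L) w)).trace * lam +
    toPlace w.1 w₁ ((γH.1.val : GL (Fin 2) (LocalRing L v)).val.map (Pi.evalRingHom (fun w' : PlacesOver L v => w'.1.adicCompletion L) w)).det = 0)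
  (hφx : φ ((finGammaTwo L v γH w, lam) : w.1.adicCompletion L × w₁.1.adicCompletion M) =
    φb (((γH.1.val : GL (Fin 2) (LocalRing L v)).val.map (Pi.evalRingHom (fun w' : PlacesOver L v => w'.1.adicCompletion L) w)), finGammaTwo L v γH w))
  (hK : IsUnit (Matrix.of fun i j : Fin 3 =>
    (((φb (((γH.1.val : GL (Fin 2) (LocalRing L v)).val.map (Pi.evalRingHom (fun w' : PlacesOver L v => w'.1.adicCompletion L) w)), finGammaTwo L v γH w)) ^ (j : ℕ)) *ᵥ
      ((cfr : Matrix (Fin 3) (Fin 3) (w.1.adicCompletion L)) *ᵥ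
        (Pi.single (endoPerm (Sum.inl 0)) (1 : w.1.adicCompletion L) + Pi.single (endoPerm (Sum.inr 0)) (1 : w.1.adicCompletion L)))) i).det)
  (hall : ∀ x : w.1.adicCompletion L × w₁.1.adicCompletion M, ∃ Q : (w.1.adicCompletion L)[X],
    aeval ((finGammaTwo L v γH w, lam) : w.1.adicCompletion L × w₁.1.adicCompletion M) Q = x)
  (hcoordlam : ∀ z : w₁.1.adicCompletion M, ∃ p q : w.1.adicCompletion L, z = toPlace w.1 w₁ p + toPlace w.1 w₁ q * lam)
  (P : (w.1.adicCompletion L)[X]) (hP : ∀ i, P.coeff i ∈ 𝒪[w.1.adicCompletion L])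
  (hPx : aeval ((finGammaTwo L v γH w, lam) : w.1.adicCompletion L × w₁.1.adicCompletion M) P =
    (galAdicCompletionMap (L := L) (IsCMField.complexConj L) hw (finGammaTwo L v γH w), s' lam))
  (hgateV : ∀ (u' p' q' t' D' : w.1.adicCompletion L) (N'' b' : ℕ),
    ((u', toPlace w.1 w₁ p' + toPlace w.1 w₁ q' * θ) : w.1.adicCompletion L × w₁.1.adicCompletion M) *
      RingHom.prodMap (galAdicCompletionMap (L := L) (IsCMField.complexConj L) hw) s'
        ((u', toPlace w.1 w₁ p' + toPlace w.1 w₁ q' * θ) : w.1.adicCompletion L × w₁.1.adicCompletion M) = 1 →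
    Valued.v (u' - 1) < 1 → Valued.v (p' - 1) < 1 → Valued.v q' = WithZero.exp (-(N'' : ℤ)) →
    (toPlace w.1 w₁ p' + toPlace w.1 w₁ q' * θ) ^ 2 - toPlace w.1 w₁ t' * (toPlace w.1 w₁ p' + toPlace w.1 w₁ q' * θ) + toPlace w.1 w₁ D' = 0 →
    Valued.v (u' * u' - t' * u' + D') = WithZero.exp (-(b' : ℤ)) →
    ((∃ x : Fin 3 → w.1.adicCompletion L, ∃ g₁ ∈ unitaryGroupOfForm (galAdicCompletionMap (L := L) (IsCMField.complexConj L) hw)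
        ((StdForm.antidiagonal 3).over (w.1.adicCompletion L)),
      Submodule.span 𝒪[w.1.adicCompletion L] (Set.range fun k : Fin 3 =>
        ((φ ((u', toPlace w.1 w₁ p' + toPlace w.1 w₁ q' * θ) : w.1.adicCompletion L × w₁.1.adicCompletion M)) ^ (k : ℕ)) *ᵥ x) =
        Submodule.span 𝒪[w.1.adicCompletion L] (Set.range ((g₁ : Matrix (Fin 3) (Fin 3) (w.1.adicCompletion L)))ᵀ)) ↔
    Even (WithZero.log (Valued.v (∑ k, ∑ i,
      galAdicCompletionMap (L := L) (IsCMField.complexConj L) hw (((cfr : Matrix (Fin 3) (Fin 3) (w.1.adicCompletion L)) *ᵥ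
        Pi.single (endoPerm (Sum.inr 0)) (1 : w.1.adicCompletion L)) i) *
      (StdForm.antidiagonal 3).over (w.1.adicCompletion L) i k *
      ((cfr : Matrix (Fin 3) (Fin 3) (w.1.adicCompletion L)) *ᵥ Pi.single (endoPerm (Sum.inr 0)) (1 : w.1.adicCompletion L)) k)) + b')))

set_option synthInstance.maxHeartbeats 200000 in
set_option maxHeartbeats 1600000 in
-- the strata sets, the lattice sets and ★ F5-(0)'s ≈ 50-binder instantiation are large terms (★ `…UnitRow` ∕ ★ GSide budgets)
include hH' hv hH'u hirr h ht hcj hTint hJT haF hk₀ hθ hθv hcoord hint hs'ι hs'θ hs's' hs'O hs'v hnorm1 hcfr hφb hφ hstar hϖ hΘ hΘd hΘt hrel hn hb hg2 hu2 hlam hφx hall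
  hcoordlam hP hPx hgateV in
open scoped Classical in
/-- **THE KEY STEP (both classes)**: the level-two stratum is (W2)'s level-two count at `J₀`, `c_fr`, read by ★ F5-(0) at the twice-shifted exponents; class I iff `κ_v(γ_H, δ) = 1`.
[cite: Rogawski1990, §4.9 Lemma 4.9.3 p. 56, Prop. 4.9.1 (b) p. 55] [cite: Flicker1998UnitaryFL, Prop. 11 p. 87, Props. 16–17 pp. 96–97] -/
private theorem ncard_levelTwo_eq_and_token_iff (hn4 : 4 ≤ n) (hN2 : 2 ≤ N) :
    (({q : (cmDatum L 3 H').Local v ⧸ cmLocalIntegralLevel L 3 H' v |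
            q ∈ MulAction.fixedBy ((cmDatum L 3 H').Local v ⧸ cmLocalIntegralLevel L 3 H' v) δ ∧
              IsIntMatrix ((ϖ ^ 2)⁻¹ • ((((q.out⁻¹ * δ * q.out : (cmDatum L 3 H').Local v)).val : GL (Fin 3) (LocalRing L v)).val.map
                (Pi.evalRingHom (fun w' : UnitaryGroup.PlacesOver L v => w'.1.adicCompletion L) w) - 1))}.ncard : ℕ) : ℚ) =
      (if finKappaAt L v H' γH δ = 1 then phiTHn (Nat.card 𝓀[v.adicCompletion ↥(maximalRealSubfield L)]) (n - 4) (N - 2)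
        else phiTHprimen (Nat.card 𝓀[v.adicCompletion ↥(maximalRealSubfield L)]) (n - 4) (N - 2)) := by
  classical
  have hc1 : IsCMField.complexConj L ≠ 1 := IsCMField.complexConj_ne_one L
  haveI : Algebra.IsQuadraticExtension ↥(maximalRealSubfield L) L := IsCMField.isQuadraticExtension L
  set σ : w.1.adicCompletion L →+* w.1.adicCompletion L := galAdicCompletionMap (L := L) (IsCMField.complexConj L) hw with hσdef
  set ev := Pi.evalRingHom (fun w' : PlacesOver L v => w'.1.adicCompletion L) w with hev
  have hσσ : ∀ x, σ (σ x) = x := galAdicCompletionMap_galAdicCompletionMap_of_smul_eq (IsCMField.complexConj L) w hc1 hw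
  have hvσ : ∀ x, Valued.v (σ x) = Valued.v x := fun x => valued_galAdicCompletionMap (L := L) (IsCMField.complexConj L) hw x
  have hιv : ∀ y : v.adicCompletion ↥(maximalRealSubfield L), Valued.v (toPlace v w y) = Valued.v y :=
    fun y => Literature.NumberTheory.Automorphic.Liu2021.LemD1IndexedNonVacuityInertCofinite.valued_toPlace_of_isUnramifiedIn L v hv w y
  have hϖk : Valued.v (toPlace v w k₀) = WithZero.exp (-1 : ℤ) := by rw [hιv, hk₀]
  have hϖ0 : toPlace v w k₀ ≠ 0 := fun h0 => by rw [h0, map_zero] at hϖk; exact WithZero.coe_ne_zero hϖk.symm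
  have hϖ1 : Valued.v (toPlace v w k₀) ≤ 1 := by rw [hϖk, ← WithZero.exp_zero]; exact WithZero.exp_le_exp.2 (by norm_num)
  -- ### (1) (B2f) at `ϖ := ι_w k₀`: the level-two stratum is the LEVEL-TWO `J₀`-lattice count at `T δ_w T⁻¹`; the statement's `ϖ²`-token is `(ι_w k₀)²`'s (`|ϖ| = |ι_w k₀|`)
  have hrow := ncard_fixedBy_levelTwo_eq_ncard_isSelfDualLattice_stable_levelTwo_of_frame L H' w hw hv δ ht T hTint hJT hϖk
  have hvv : Valued.v ((ϖ ^ 2)⁻¹ : w.1.adicCompletion L) = Valued.v (((toPlace v w k₀) ^ 2)⁻¹ : w.1.adicCompletion L) := by rw [map_inv₀, map_inv₀, map_pow, map_pow, hϖ, hϖk]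
  simp only [fun X : Matrix (Fin 3) (Fin 3) (w.1.adicCompletion L) => isIntMatrix_smul_iff_of_v_eq hvv X]
  -- ### (2) the form `J₀` as a unit: integral, hermitian, `L₀` self-dual, transitivity (2-free)
  have hΦw : IsUnit (placeForm ((StdForm.antidiagonal 3).over L) w.1) := by
    rw [placeForm_antidiagonal]; exact (StdForm.antidiagonal 3).isUnit_over _
  have hJ : hΦw.unit ∈ glInt 3 (w.1.adicCompletion L) := isUnit_placeForm_antidiagonal_unit_mem_glInt (E := L) (N := 3) w.1 hΦw
  have hJ0m : ((hΦw.unit : GL (Fin 3) (w.1.adicCompletion L)) : Matrix (Fin 3) (Fin 3) (w.1.adicCompletion L)) =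
      (StdForm.antidiagonal 3).over (w.1.adicCompletion L) := by rw [IsUnit.unit_spec, placeForm_antidiagonal]
  have hJh : (((hΦw.unit : GL (Fin 3) (w.1.adicCompletion L)) : Matrix (Fin 3) (Fin 3) (w.1.adicCompletion L)).map σ)ᵀ = hΦw.unit := by
    rw [hJ0m, StdForm.over_map, StdForm.transpose_over]
  have hL₀ : IsSelfDualLattice σ (toPlace v w k₀) ((hΦw.unit : GL (Fin 3) (w.1.adicCompletion L)) : Matrix (Fin 3) (Fin 3) (w.1.adicCompletion L))
      (stdLattice (w.1.adicCompletion L) 3) := by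
    rw [hJ0m]; exact isSelfDualLattice_stdLattice_three_of_v hϖk
  have htrace : ∃ t : w.1.adicCompletion L, Valued.v t ≤ 1 ∧ t + σ t = 1 := by
    let σO := (galAdicCompletionMap (L := L) (IsCMField.complexConj L) hw).restrict (ValuativeRel.valuation (w.1.adicCompletion L)).integer _
      fun x hx => galAdicCompletionMap_mem_integer (IsCMField.complexConj L) w hw hx
    obtain ⟨t, ht1⟩ := exists_add_map_eq_one_integer (IsCMField.complexConj L) w hc1 hw hv σO (fun _ => rfl) fun x => Subtype.ext (hσσ x)
    exact ⟨t, (v_le_one_iff_mem_integer (t : w.1.adicCompletion L)).2 t.2, congrArg Subtype.val ht1⟩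
  have htrans : ∀ Λ : Submodule (Valued.integer (w.1.adicCompletion L)) (Fin 3 → w.1.adicCompletion L),
      IsSelfDualLattice σ (toPlace v w k₀) ((hΦw.unit : GL (Fin 3) (w.1.adicCompletion L)) : Matrix (Fin 3) (Fin 3) (w.1.adicCompletion L)) Λ →
        ∃ g₁ : ↥(unitaryGroupOfForm σ ((hΦw.unit : GL (Fin 3) (w.1.adicCompletion L)) : Matrix (Fin 3) (Fin 3) (w.1.adicCompletion L))),
          Λ = mapGL ((g₁ : ↥(unitaryGroupOfForm σ ((hΦw.unit : GL (Fin 3) (w.1.adicCompletion L)) : Matrix (Fin 3) (Fin 3) (w.1.adicCompletion L)))) :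
            GL (Fin 3) (w.1.adicCompletion L)) (stdLattice (w.1.adicCompletion L) 3) := by
    rw [hJ0m]
    intro Λ hΛ
    obtain ⟨g₁, hg₁⟩ := exists_unitary_mapGL_stdLattice_eq_of_isSelfDualLattice_of_trace hσσ hvσ hϖk htrace hΛ
    exact ⟨g₁, hg₁.symm⟩
  -- ### (3) the block frame: `φ_b(g_w, u_w) = T δ_w T⁻¹` (★ (O-5)-place at `c`, then conjugation by `T`)
  set cw : GL (Fin 3) (w.1.adicCompletion L) := Units.map (RingHom.mapMatrix ev).toMonoidHom cj with hcw
  have hcwval : (cw : Matrix (Fin 3) (Fin 3) (w.1.adicCompletion L)) = ((cj : GL (Fin 3) (LocalRing L v)) : Matrix (Fin 3) (Fin 3) (LocalRing L v)).map ev := rfl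
  have hcfr' : cfr = T * cw := Units.ext (by rw [Units.val_mul, hcwval, hcfr])
  obtain ⟨φ₀, hφ₀, hφ₀w⟩ := exists_algHom_blockFrame_apply_eq_of_conj_place L H' w γH hcj
  have hframe : φb (((γH.1.val : GL (Fin 2) (LocalRing L v)).val.map ev), finGammaTwo L v γH w) =
      (T : Matrix (Fin 3) (Fin 3) (w.1.adicCompletion L)) *
        ((δ.val : GL (Fin 3) (LocalRing L v)) : Matrix (Fin 3) (Fin 3) (LocalRing L v)).map ev *
        ((T⁻¹ : GL (Fin 3) (w.1.adicCompletion L)) : Matrix (Fin 3) (Fin 3) (w.1.adicCompletion L)) := by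
    have e1 := hφ₀ (((γH.1.val : GL (Fin 2) (LocalRing L v)).val.map ev)) (finGammaTwo L v γH w)
    rw [hφ₀w] at e1
    rw [hφb, hcfr', _root_.mul_inv_rev, Units.val_mul, Units.val_mul, e1]
    simp only [Matrix.mul_assoc]
    rfl
  -- ### (4) the eigenvector `p′ = c e₃` of `δ`, its `H′_v`-value `x₀ ∈ L⁺_v`, `x₀ ≠ 0`, and the κ-reading
  obtain ⟨δ₁, hcδ, hδ₁⟩ := Literature.NumberTheory.Weil1982.UnitaryFinTopForm.exists_complexConj_eq_neg_ne_zero L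
  have hF := Liu2021.LemD1IndexedNonVacuityNonsplitPlace.isField_localRing_of_nonsplit L v (IsCMField.complexConj L) hcδ hδ₁ w hw
  letI : Field (UnitaryGroup.LocalRing L v) := hF.toField
  have hA : Irreducible ((γH.1.val : GL (Fin 2) (UnitaryGroup.LocalRing L v)).val.charpoly) :=
    irreducible_charpoly_of_not_exists_isRoot_eval L v w hw _ hirr
  have hA' : ∀ r : UnitaryGroup.LocalRing L v, (γH.1.val : GL (Fin 2) (UnitaryGroup.LocalRing L v)).val.charpoly.eval r ≠ 0 :=
    Literature.LinearAlgebra.Matrix.eval_charpoly_ne_zero_of_irreducible hA (by simp)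
  have hu : IsUnit ((finCharpolyTwo L v γH).eval (finGammaTwo L v γH)) := by
    obtain ⟨y, hy⟩ := hF.mul_inv_cancel (hA' (finGammaTwo L v γH))
    exact IsUnit.of_mul_eq_one _ hy
  have hH'c : (H'.map (cmConjRingHom L))ᵀ = H' := by
    have e1 : H'.map (cmConjRingHom L) = H'.map (IsCMField.complexConj L) := by
      ext i j; simp [Matrix.map_apply, cmConjRingHom_apply]
    rw [e1]; exact hH'
  have hσσv : ∀ s, UnitaryGroup.conjLocal L (IsCMField.complexConj L) v (UnitaryGroup.conjLocal L (IsCMField.complexConj L) v s) = s :=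
    Liu2021.LemD1OfPlace.conjLocal_conjLocal_apply L v (IsCMField.complexConj L) hcδ hδ₁
  have hH := UnitaryGroup.map_conjLocal_transpose_localForm L 3 H' v hH'c
  have hHd := UnitaryGroup.isUnit_det_localForm L 3 H' v (Matrix.isUnit_iff_isUnit_det _ |>.1 hH'u).ne_zero
  have hfr := mul_eq_mul_reindex_fromBlocks_of_conj_endoEmbLocal_eq L H' γH hcj
  set p' : Fin 3 → UnitaryGroup.LocalRing L v := fun i => cj.val i (endoPerm (Sum.inr 0)) with hp'def
  have hp' : (δ.val.val : Matrix (Fin 3) (Fin 3) (UnitaryGroup.LocalRing L v)) *ᵥ p' = finGammaTwo L v γH • p' :=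
    mulVec_col_eq_smul_of_blockFrame endoPerm hfr
  have hne : p' ≠ 0 := by
    intro h0
    apply (Matrix.isUnits_det_units cj).ne_zero
    exact Matrix.det_eq_zero_of_column_eq_zero (endoPerm (Sum.inr 0)) fun i => congrFun h0 i
  obtain ⟨x₀, hx₀⟩ := exists_toLocalRing_eq_formValue L v H' hH'c p'
  have hval0 : (∑ i : Fin 3, ∑ k : Fin 3, UnitaryGroup.conjLocal L (IsCMField.complexConj L) v (p' i) *
      ((UnitaryGroup.adelicForm L 3 H').map (UnitaryGroup.adeleToLocal L v)) i k * p' k) ≠ 0 := by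
    obtain ⟨G₁, g₃, hTw, -, -⟩ := twistGram_blockFrame_eq (UnitaryGroup.conjLocal L (IsCMField.complexConj L) v) endoPerm _ hσσv δ.2 hfr hA'
    obtain ⟨-, -, -, hg₃0⟩ := blockFrame_gram_hermitian (UnitaryGroup.conjLocal L (IsCMField.complexConj L) v) endoPerm _ hσσv hH hHd.ne_zero hTw
    rw [← twistGram_apply_self_eq_formValue, hTw, blockFrame_apply_corner]
    exact hg₃0
  have hx₀0 : x₀ ≠ 0 := fun h0 => hval0 (by rw [← hx₀, h0, map_zero])
  have hvx₀0 : Valued.v x₀ ≠ 0 := (Valuation.ne_zero_iff _).2 hx₀0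
  have hite := finKappaAt_eq_ite_even_of_nonsplit_of_isUnramifiedIn L v H' γH δ w hw hv h hu hp' hne x₀ hx₀0 hx₀
  -- ### (5) the token vector `c_fr e₃ = T (c e₃)_w` and its `J₀`-value `ι_w x₀`
  set pw : Fin 3 → w.1.adicCompletion L := fun i => p' i w with hpw
  have hcol : (cfr : Matrix (Fin 3) (Fin 3) (w.1.adicCompletion L)) *ᵥ Pi.single (endoPerm (Sum.inr 0)) (1 : w.1.adicCompletion L) =
      (T : Matrix (Fin 3) (Fin 3) (w.1.adicCompletion L)) *ᵥ pw := by
    rw [Matrix.mulVec_single_one, hcfr]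
    ext i
    simp only [Matrix.col_apply, Matrix.mul_apply, Matrix.mulVec, dotProduct, Matrix.map_apply, hpw, hp'def]
    rfl
  have hvalue : dotProduct (fun i => σ (((cfr : Matrix (Fin 3) (Fin 3) (w.1.adicCompletion L)) *ᵥ Pi.single (endoPerm (Sum.inr 0)) (1 : w.1.adicCompletion L)) i))
      ((StdForm.antidiagonal 3).over (w.1.adicCompletion L) *ᵥ ((cfr : Matrix (Fin 3) (Fin 3) (w.1.adicCompletion L)) *ᵥ
        Pi.single (endoPerm (Sum.inr 0)) (1 : w.1.adicCompletion L))) = toPlace v w x₀ := by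
    have key : ∀ (A : Matrix (Fin 3) (Fin 3) (w.1.adicCompletion L)) (q : Fin 3 → w.1.adicCompletion L),
        dotProduct (fun i => σ (q i)) (A *ᵥ q) = ∑ i, ∑ k, σ (q i) * A i k * q k := by
      intro A q
      simp only [dotProduct, Matrix.mulVec, Finset.mul_sum, mul_assoc]
    rw [key, hcol, sum_map_mulVec_mul_mulVec_eq_of_formCongr_eq σ T hJT.symm pw]
    have e2 := congrFun hx₀ w
    rw [UnitaryGroup.toLocalRing_apply] at e2
    rw [e2]
    simp only [Finset.sum_apply, Pi.mul_apply, hpw]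
    refine Finset.sum_congr rfl fun i _ => Finset.sum_congr rfl fun k _ => ?_
    rw [conjLocal_apply_eq_galAdicCompletionMap L v w hw, UnitaryGroup.adelicForm_map_adeleToLocal, Matrix.map_apply]
    rfl
  -- the token in ★ F5-(0)'s `ValuativeRel` currency ⟺ `|z|²|x₀| = 1` ⟺ (§1) `ord_v x₀` even
  have htoken : ∀ z : w.1.adicCompletion L, valuation (w.1.adicCompletion L) (σ z * z * toPlace v w x₀) = 1 ↔ Valued.v z ^ 2 * Valued.v x₀ = 1 := fun z => by
    rw [← v_eq_one_iff_valuation_eq_one, map_mul, map_mul, hvσ, hιv, sq]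
  have hpar := exists_ne_zero_and_valuation_sq_mul_eq_one_iff_even_log hϖ hvx₀0
  -- ### (6) the Eisenstein letters in ★ F5-(0)'s `ι_w k₀`-currency; integrality of `g_w`, `u_w`
  have hΘd' : Valued.v Θ.det = Valued.v (toPlace v w k₀) := by rw [hΘd, hϖ, hϖk]
  have hb' : Valued.v b = Valued.v (toPlace v w k₀) ^ N := by rw [hb, hϖ, hϖk]
  have hn' : Valued.v (finGammaTwo L v γH w • (1 : Matrix (Fin 2) (Fin 2) (w.1.adicCompletion L)) -
      (γH.1.val : GL (Fin 2) (LocalRing L v)).val.map ev).det = Valued.v (toPlace v w k₀) ^ n := by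
    have e1 : (finGammaTwo L v γH w • (1 : Matrix (Fin 2) (Fin 2) (w.1.adicCompletion L)) - (γH.1.val : GL (Fin 2) (LocalRing L v)).val.map ev).det =
        ((finCharpolyTwo L v γH).eval (finGammaTwo L v γH)) w := by
      rw [eval_finCharpolyTwo_finGammaTwo, Matrix.det_fin_two]
      simp only [hev, Pi.evalRingHom_apply, Pi.add_apply, Pi.sub_apply, Pi.mul_apply, Matrix.trace_fin_two, Matrix.det_fin_two, Matrix.sub_apply,
        Matrix.smul_apply, Matrix.map_apply, Matrix.one_apply_eq, Matrix.one_apply_ne (by decide : (0 : Fin 2) ≠ 1),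
        Matrix.one_apply_ne (by decide : (1 : Fin 2) ≠ 0), smul_eq_mul, mul_one, mul_zero]
      ring
    rw [e1, hn, hϖk, ← WithZero.exp_nsmul]
    simp
  -- ### (7) ★ `shift_pairLetters` AT `(ι_w k₀)²`: ★ F5-(0)'s pair letters at the TWICE-SHIFTED pair (`g₁₀ ≠ 0`, `χ_g(u) ≠ 0` from the Eisenstein data, ★ (c5-i))
  obtain ⟨-, -, hirr', h10⟩ := charpoly_ne_zero_of_eisensteinData hϖk hΘ hΘd' hΘt
  have hσO : ∀ x : 𝒪[w.1.adicCompletion L], σ x ∈ 𝒪[w.1.adicCompletion L] := fun x => mem_integer_galAdicCompletionMap (IsCMField.complexConj L) v w hw x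
  have hϖO : toPlace v w k₀ ∈ 𝒪[w.1.adicCompletion L] := (v_le_one_iff_mem_integer _).1 hϖ1
  have hσϖ : σ (toPlace v w k₀) = toPlace v w k₀ := galAdicCompletionMap_toPlace (IsCMField.complexConj L) w w hw k₀
  have hk2v : Valued.v ((toPlace v w k₀) ^ 2) = WithZero.exp (-2 : ℤ) := by rw [map_pow, hϖk, ← WithZero.exp_nsmul]; norm_num
  have hg2' : ∀ i j, Valued.v ((((γH.1.val : GL (Fin 2) (LocalRing L v)).val.map ev) - 1) i j) ≤ Valued.v ((toPlace v w k₀) ^ 2) := fun i j => by rw [hk2v]; exact hg2 i j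
  have hu2' : Valued.v (finGammaTwo L v γH w - 1) ≤ Valued.v ((toPlace v w k₀) ^ 2) := by rw [hk2v]; exact hu2
  have hσϖ2 : σ ((toPlace v w k₀) ^ 2) = (toPlace v w k₀) ^ 2 := by rw [map_pow, hσϖ]
  obtain ⟨hgS, huS, -, hlamS, hφxS, hKS, hallS, hcoordS, P', hP', hPx'⟩ := shift_pairLetters σ s' hs'ι hσO (pow_ne_zero 2 hϖ0) (pow_mem hϖO 2) hσϖ2
    cfr φb hφb φ hg2' hu2' h10
    (hirr' (finGammaTwo L v γH w)) hlam hφx hall hcoordlam hP hPx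
  -- the side condition `C` = ★ F5-(0)'s pair letters, and the shifted pair carries it
  set C : Matrix (Fin 2) (Fin 2) (w.1.adicCompletion L) → w.1.adicCompletion L → Prop := fun g u =>
    (∀ i j, g i j ∈ 𝒪[w.1.adicCompletion L]) ∧ u ∈ 𝒪[w.1.adicCompletion L] ∧ ∃ lam' : w₁.1.adicCompletion M,
      lam' ^ 2 - toPlace w.1 w₁ g.trace * lam' + toPlace w.1 w₁ g.det = 0 ∧ φ ((u, lam') : w.1.adicCompletion L × w₁.1.adicCompletion M) = φb (g, u) ∧
      IsUnit (Matrix.of fun i j : Fin 3 => (((φb (g, u)) ^ (j : ℕ)) *ᵥ ((cfr : Matrix (Fin 3) (Fin 3) (w.1.adicCompletion L)) *ᵥ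
        (Pi.single (endoPerm (Sum.inl 0)) (1 : w.1.adicCompletion L) + Pi.single (endoPerm (Sum.inr 0)) (1 : w.1.adicCompletion L)))) i).det ∧
      (∀ x : w.1.adicCompletion L × w₁.1.adicCompletion M, ∃ Q : (w.1.adicCompletion L)[X], aeval ((u, lam') : w.1.adicCompletion L × w₁.1.adicCompletion M) Q = x) ∧
      (∀ z : w₁.1.adicCompletion M, ∃ p q : w.1.adicCompletion L, z = toPlace w.1 w₁ p + toPlace w.1 w₁ q * lam') ∧
      ∃ P'' : (w.1.adicCompletion L)[X], (∀ i, P''.coeff i ∈ 𝒪[w.1.adicCompletion L]) ∧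
        aeval ((u, lam') : w.1.adicCompletion L × w₁.1.adicCompletion M) P'' = (σ u, s' lam') with hCdef
  have hCg' : C (((toPlace v w k₀) ^ 2)⁻¹ • (((γH.1.val : GL (Fin 2) (LocalRing L v)).val.map ev) - 1)) (((toPlace v w k₀) ^ 2)⁻¹ * (finGammaTwo L v γH w - 1)) :=
    ⟨hgS, huS, _, hlamS, hφxS, hKS, hallS, hcoordS, P', hP', hPx'⟩
  -- ### (8) the two classes: (W2) (level two of a total) over ★ F5-(0) as the total count function
  rw [hrow]
  split_ifs with hκ
  · -- CLASS I: `κ = 1` ⇒ `ord_v x₀` even ⇒ the token holds; `G := phiTHn q`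
    have heven : Even (WithZero.log (Valued.v x₀)) := by
      by_contra hodd; rw [hκ, if_neg hodd] at hite; norm_num at hite
    obtain ⟨z, hz0, hz⟩ := hpar.2 heven
    have hED := cast_ncard_vertex_levelTwo_eq_of_total σ hϖ0 hϖ1 ((StdForm.antidiagonal 3).over (w.1.adicCompletion L)) 0 φb C
      (fun n' N' => phiTHn (Nat.card 𝓀[v.adicCompletion ↥(maximalRealSubfield L)]) n' N')
      (fun g' Θ' u' α' β' a' b' n' N' hC hΘ' hΘd'' hΘt' hrel' hn'' hb'' => by
        obtain ⟨hg', hu'', lam', hlam', hφx', hK', hall', hcoordlam', P'', hP'', hPx''⟩ := hC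
        have hF5 := ncard_isSelfDualLattice_stable_eq_phiTHn_inertPlace (IsCMField.complexConj L) v hc1 hv w hw w₁ haF hk₀ s' hθ hθv hcoord hint hs'ι hs'θ hs's'
          hs'O hs'v hnorm1 hΦw.unit hJ hJh hL₀ htrans cfr φb hφb φ hφ (fun b₁ => by rw [hJ0m]; exact hstar b₁) hg' hu'' hΘ' hΘd'' hΘt' hrel' hn'' hb'' hlam' hφx' hK'
          hall' hcoordlam' P'' hP'' hPx'' (by rw [hJ0m]; exact hgateV) ⟨z, hz0, by rw [hJ0m, hvalue]; exact (htoken z).2 hz⟩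
        rw [hJ0m] at hF5
        exact hF5)
      hCg' hΘ hΘd' hΘt hrel hn' hb' hn4 hN2
    rw [hframe] at hED
    exact hED
  · -- CLASS II: `κ = −1` ⇒ `ord_v x₀` odd ⇒ the token fails; `G := phiTHprimen q`
    have hκ' : finKappaAt L v H' γH δ = -1 := (finKappaAt_eq_one_or_eq_neg_one_of_isUnit L v H' γH δ h hu).resolve_left hκ
    have hodd : ¬ Even (WithZero.log (Valued.v x₀)) := by
      intro heven; rw [hκ', if_pos heven] at hite; norm_num at hite
    have hED := cast_ncard_vertex_levelTwo_eq_of_total σ hϖ0 hϖ1 ((StdForm.antidiagonal 3).over (w.1.adicCompletion L)) 0 φb C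
      (fun n' N' => phiTHprimen (Nat.card 𝓀[v.adicCompletion ↥(maximalRealSubfield L)]) n' N')
      (fun g' Θ' u' α' β' a' b' n' N' hC hΘ' hΘd'' hΘt' hrel' hn'' hb'' => by
        obtain ⟨hg', hu'', lam', hlam', hφx', hK', hall', hcoordlam', P'', hP'', hPx''⟩ := hC
        have hF5 := ncard_isSelfDualLattice_stable_eq_phiTHprimen_inertPlace (IsCMField.complexConj L) v hc1 hv w hw w₁ haF hk₀ s' hθ hθv hcoord hint hs'ι hs'θ hs's'
          hs'O hs'v hnorm1 hΦw.unit hJ hJh hL₀ htrans cfr φb hφb φ hφ (fun b₁ => by rw [hJ0m]; exact hstar b₁) hg' hu'' hΘ' hΘd'' hΘt' hrel' hn'' hb'' hlam' hφx' hK'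
          hall' hcoordlam' P'' hP'' hPx'' (by rw [hJ0m]; exact hgateV)
          (fun z hz0 hz => hodd (hpar.1 ⟨z, hz0, (htoken z).1 (by rw [hJ0m, hvalue] at hz; exact hz)⟩))
        rw [hJ0m] at hF5
        exact hF5)
      hCg' hΘ hΘd' hΘt hrel hn' hb' hn4 hN2
    rw [hframe] at hED
    exact hED

include hH' hv hH'u hirr h ht hcj hTint hJT haF hk₀ hθ hθv hcoord hint hs'ι hs'θ hs's' hs'O hs'v hnorm1 hcfr hφb hφ hstar hϖ hΘ hΘd hΘt hrel hn hb hg2 hu2 hlam hφx hall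
  hcoordlam hP hPx hgateV in
open scoped Classical in
/-- **(B2g), CLASS I: `n₀⁽²⁾(δ) = #{q ∈ Fix_δ : (q⁻¹δq)_w ≡ 1 (mod ϖ²)} = Φ_{n−4}(N−2) = phiTHn q (n−4) (N−2)` for a 2-deep type-(2) match with `κ_v(γ_H, δ) = +1`** (`n ≥ 4`, `N ≥ 2`),
at an integral frame `T` of `H′_w` and the block frame `c_fr = T·c_w`, over the Eisenstein letters, the depth-two letters `hg2 hu2` and ★ F5-(0)'s row-∕pair-level block; `q = #𝓀(L⁺_v)`.
[cite: Rogawski1990, §4.9 Lemma 4.9.3 p. 56, Prop. 4.9.1 (b) p. 55] [cite: Kottwitz1986BaseChangeUnits, §1 pp. 240–241, §2 pp. 244–247] [cite: Flicker1998UnitaryFL, Prop. 11 p. 87; Theorem 18 p. 97] -/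
theorem ncard_levelTwo_eq_phiTHn_of_frame_of_finKappaAt_eq_one (hn4 : 4 ≤ n) (hN2 : 2 ≤ N) (hκ : finKappaAt L v H' γH δ = 1) :
    (({q : (cmDatum L 3 H').Local v ⧸ cmLocalIntegralLevel L 3 H' v |
            q ∈ MulAction.fixedBy ((cmDatum L 3 H').Local v ⧸ cmLocalIntegralLevel L 3 H' v) δ ∧
              IsIntMatrix ((ϖ ^ 2)⁻¹ • ((((q.out⁻¹ * δ * q.out : (cmDatum L 3 H').Local v)).val : GL (Fin 3) (LocalRing L v)).val.map
                (Pi.evalRingHom (fun w' : UnitaryGroup.PlacesOver L v => w'.1.adicCompletion L) w) - 1))}.ncard : ℕ) : ℚ) =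
      phiTHn (Nat.card 𝓀[v.adicCompletion ↥(maximalRealSubfield L)]) (n - 4) (N - 2) := by
  have key := ncard_levelTwo_eq_and_token_iff hH' w hw hv hH'u hirr δ h ht hcj T hTint hJT w₁ haF hk₀ s' hθ hθv hcoord hint hs'ι hs'θ hs's' hs'O hs'v hnorm1
    cfr hcfr φb hφb φ hφ hstar hϖ hΘ hΘd hΘt hrel n N hn hb hg2 hu2 hlam hφx hall hcoordlam P hP hPx hgateV hn4 hN2
  rwa [if_pos hκ] at key

include hH' hv hH'u hirr h ht hcj hTint hJT haF hk₀ hθ hθv hcoord hint hs'ι hs'θ hs's' hs'O hs'v hnorm1 hcfr hφb hφ hstar hϖ hΘ hΘd hΘt hrel hn hb hg2 hu2 hlam hφx hall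
  hcoordlam hP hPx hgateV in
open scoped Classical in
/-- **(B2g), CLASS II: `n₀⁽²⁾(δ) = Φ′_{n−4}(N−2) = phiTHprimen q (n−4) (N−2)` for a 2-deep type-(2) match with `κ_v(γ_H, δ) = −1`** (same frame, same letters).
[cite: Rogawski1990, §4.9 Lemma 4.9.3 p. 56, Prop. 4.9.1 (b) p. 55] [cite: Kottwitz1986BaseChangeUnits, §1 pp. 240–241, §2 pp. 244–247] [cite: Flicker1998UnitaryFL, Props. 16–17 pp. 96–97; Theorem 18 p. 97] -/
theorem ncard_levelTwo_eq_phiTHprimen_of_frame_of_finKappaAt_eq_neg_one (hn4 : 4 ≤ n) (hN2 : 2 ≤ N) (hκ : finKappaAt L v H' γH δ = -1) :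
    (({q : (cmDatum L 3 H').Local v ⧸ cmLocalIntegralLevel L 3 H' v |
            q ∈ MulAction.fixedBy ((cmDatum L 3 H').Local v ⧸ cmLocalIntegralLevel L 3 H' v) δ ∧
              IsIntMatrix ((ϖ ^ 2)⁻¹ • ((((q.out⁻¹ * δ * q.out : (cmDatum L 3 H').Local v)).val : GL (Fin 3) (LocalRing L v)).val.map
                (Pi.evalRingHom (fun w' : UnitaryGroup.PlacesOver L v => w'.1.adicCompletion L) w) - 1))}.ncard : ℕ) : ℚ) =
      phiTHprimen (Nat.card 𝓀[v.adicCompletion ↥(maximalRealSubfield L)]) (n - 4) (N - 2) := by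
  have key := ncard_levelTwo_eq_and_token_iff hH' w hw hv hH'u hirr δ h ht hcj T hTint hJT w₁ haF hk₀ s' hθ hθv hcoord hint hs'ι hs'θ hs's' hs'O hs'v hnorm1
    cfr hcfr φb hφb φ hφ hstar hϖ hΘ hΘd hΘt hrel n N hn hb hg2 hu2 hlam hφx hall hcoordlam P hP hPx hgateV hn4 hN2
  rwa [if_neg (by rw [hκ]; norm_num)] at key

end Frame

end Literature.NumberTheory.Rogawski1990

end
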